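import Summits.BirchSwinnertonDyer.BirchSwinnertonDyer.Theses.CumulativeHeegnerLeopoldt
import Summits.BirchSwinnertonDyer.BirchSwinnertonDyer.Theorems.AdditivePotSupersingularControlOfFacts
import Summits.BirchSwinnertonDyer.BirchSwinnertonDyer.Theorems.CumulativeHeegnerLeopoldtRedSplitControlAtThreeTorsionFree
import Summits.BirchSwinnertonDyer.Rank1Residual.GaloisImage.PropagatedConditionCardEP
import Literature.NumberTheory.EllipticCurves.Serre1967.PotentiallySupersingularNoStableLineProofs
import Literature.NumberTheory.EllipticCurves.AnticyclotomicPrimeDecompositionSplitProofs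
import Literature.NumberTheory.EllipticCurves.AnticyclotomicPrimeDecompositionAboveProofs
import Literature.NumberTheory.GaloisRepresentations.NumberFieldCdTwoProofs
import HarnessLib

/-!
# Crux K4 `RedSplitControlAtThree` (stmt-BirchSwinnertonDyer-24200) BY NAME modulo Poitou–Tate at the
# TOTALLY COMPLEX fields only

Seat `bsd-line-chl-p2` g5 (cell `bsd-wall`, width prover on K4 under the lead `bsd-line-chl-p1`).  Gen 0 landed
`RedSplitControlAtThreeOfFacts.redSplitControlAtThree_of_poitouTate hPT hPT2 : RedSplitControlAtThree` with the two
Poitou–Tate named facts quantified over ALL number fields.  The K1 door it rests on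
(`SchneiderFreeAdditiveX3.additiveControlOnTreeAt_of_facts_of_localTowerTorsionFinite`) consumes both facts AT THE
HEEGNER FIELD `K` ONLY, and `K` is imaginary quadratic, hence totally complex.  This matters for the discharge: the
seat's PT2 road (`PoitouTateShaAnnihilator.*`: `exists_family_sum_localTatePairing_eq_of_isTotallyComplex`,
`natCard_shaTwo_le_of_readout`, `sha_tateDual_of_readout`) delivers `poitouTate_sha_tateDual K` for TOTALLY COMPLEX `K`
(real places would need Milne I 2.13 and the real components of the invariant maps, `poitouTate_selmerStructure_duality_real`).
Hence the sharper conditional closer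

* `redSplitControlAtThree_of_poitouTate_totallyComplex` — K4 BY NAME from
  `∀ K totally complex, poitouTate_selmerStructure_duality K` and `∀ K totally complex, poitouTate_sha_tateDual K`,
  the other five inputs of the door being tree theorems exactly as in gen 0's closer (local Euler–Poincaré
  `EP.localEulerPoincareCharacteristic_adicCompletion`, `cd ≤ 2` `fieldCdLE_two_of_numberField_holds`, Brink Thm 2 /
  Cor 1 `ZpExtension.decomp_not_le_kerSubgroup[_above]_of_isAnticyclotomic_holds`, Serre 1967 §5 Prop. 8
  `Serre1967.noStableDivisibleLine_of_potentiallySupersingular_holds` through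
  `PotentiallySupersingularLocalTorsion.localTowerTorsionFiniteAt_of_potentiallySupersingular`).

HONEST FRAMING: CONDITIONAL theorem (two named-fact hypotheses, displayed); no definition, no named fact, no `sorry`;
the item closes only when its own hypothesis-free signature is proved; BSD is not proved by any of this.

References: [JetchevSkinnerWan2017] Thm. 3.3.1, Prop. 3.3.4; [MilneADT2006] I Thm. 4.10, Thm. 2.8; [Brink2007] Thm. 2,
Cor. 1; [Serre1967GroupesPDivisibles] §5 Prop. 8; [Kolyvagin1990] Thm. A; [GrossLMS1991] §2.
-/

noncomputable section

open scoped Classical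

open WeierstrassCurve NumberField IsDedekindDomain Field Literature.NumberTheory.EllipticCurves
  Literature.NumberTheory.EllipticCurves.ModularForms
  Literature.NumberTheory.EllipticCurves.GreenbergSelmer
  Literature.NumberTheory.GaloisRepresentations
  Literature.NumberTheory.GaloisCohomology
  Literature.NumberTheory.EllipticCurves.Rank1Residual
  Summit.BirchSwinnertonDyer.Rank1Residual
  Summit.BirchSwinnertonDyer.Rank1Residual.Additive
  Summit.BirchSwinnertonDyer.Rank1Residual.X11b
  Summit.BirchSwinnertonDyer.BirchSwinnertonDyer.Theorems.SchneiderFree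
  Summit.BirchSwinnertonDyer.BirchSwinnertonDyer.Theorems.SchneiderFreeAdditiveX3

set_option linter.dupNamespace false
set_option autoImplicit false

namespace Summit.BirchSwinnertonDyer.BirchSwinnertonDyer.Theorems.RedSplitControlAtThreeOfFacts

/-- **K4 `RedSplitControlAtThree` BY NAME modulo Poitou–Tate duality at the TOTALLY COMPLEX number fields**: the
two named facts `poitouTate_selmerStructure_duality K` (Milne I 4.10 (b) / Howard 2.1.11) and
`poitouTate_sha_tateDual K` (Milne I 4.10 (a)) are consumed by the K1 door only at the Heegner field `K`, which is
imaginary quadratic; everything else (local Euler–Poincaré, `cd ≤ 2`, Brink, Serre 1967, `E(K)[3] = 0` on the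
non-anomalous cell, `SplitsIn` from Heegner, rank/`Ш` from Kolyvagin) is a tree theorem.  CONDITIONAL; closes nothing
by itself; BSD is not proved by any of this.
[cite: JetchevSkinnerWan2017, Thm. 3.3.1, Prop. 3.3.4 (arXiv:1512.06894 pp. 11–13)]
[cite: MilneADT2006, Ch. I, Thm. 4.10 and Thm. 2.8] [cite: Brink2007, Thm. 2 and Cor. 1]
[cite: Serre1967GroupesPDivisibles, §5 Prop. 8] [cite: Kolyvagin1990, Thm. A] -/
theorem redSplitControlAtThree_of_poitouTate_totallyComplex
    (hPT : ∀ (K : Type) [Field K] [NumberField K] [IsTotallyComplex K], poitouTate_selmerStructure_duality K)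
    (hPT2 : ∀ (K : Type) [Field K] [NumberField K] [IsTotallyComplex K], poitouTate_sha_tateDual K) :
    Summit.BirchSwinnertonDyer.BirchSwinnertonDyer.Theses.CumulativeHeegnerLeopoldt.RedSplitControlAtThree := by
  intro W _ _ N _ K _ _ Dt H ι P hO6 _hRed hcell _hr hN hK hHg _hLd hP hPinf hKoly κ hκ γ _ 𝔭 h𝔭 he hf
  haveI : IsTotallyComplex K := hK.2
  have hpN : 3 ∣ W.conductorNorm ℤ :=
    (W.dvd_conductorNorm_iff_not_hasGoodReductionAtPrime 3).mpr hO6.2.1.1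
  have hsplit : SplitsIn K 3 := splitsIn_of_satisfiesHeegnerHypothesis hN hHg hpN
  obtain ⟨hrank, hSha⟩ := hKoly hK hHg ⟨Dt, H, ι, hP⟩ hPinf
  have hivK : ∀ x : (W.baseChange K).toAffine.Point, 3 • x = 0 → x = 0 :=
    RedSplitControlAtThreeTorsionFree.forall_nsmul_eq_zero_of_nonAnomalousCell_of_isImaginaryQuadratic
      K hK 𝔭 h𝔭 he hf hcell
  exact additiveControlOnTreeAt_of_facts_of_localTowerTorsionFinite (hPT K) (hPT2 K)
    (fun v ↦ Summit.BirchSwinnertonDyer.Rank1Residual.GaloisImage.EP.localEulerPoincareCharacteristic_adicCompletion K v)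
    fieldCdLE_two_of_numberField_holds
    (ZpExtension.decomp_not_le_kerSubgroup_of_isAnticyclotomic_holds K 3) (by decide) hO6.2.1 hK hsplit hκ γ 𝔭
    h𝔭 he hf hivK
    (PotentiallySupersingularLocalTorsion.localTowerTorsionFiniteAt_of_potentiallySupersingular
      Serre1967.noStableDivisibleLine_of_potentiallySupersingular_holds W 3 (by decide) hO6.padicValRat_j_nonneg
      (fun _F _ _ _w hw hgood ↦
        not_hasUnitRootAt_baseChange_of_not_typeG_three W hO6.2.1 hO6.not_typeG_three.1 hw hgood)
      K κ 𝔭 h𝔭 he hf)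
    (ZpExtension.decomp_not_le_kerSubgroup_above_of_isAnticyclotomic_holds K 3 hK (by decide) κ hκ 𝔭 h𝔭)
    hrank hSha P hPinf

end Summit.BirchSwinnertonDyer.BirchSwinnertonDyer.Theorems.RedSplitControlAtThreeOfFacts

end
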